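import Summits.KontsevichZagierPeriods.KontsevichZagierPeriods.Theorems.LinRedNormalFormArrangementNormalFormStubRebaseSimpleZeroNestedDiffE2Frame

/-!
# Stub `stub_rebaseSimpleZeroTwo`, part `HPar1` (crux `ArrangementNormalForm`, line `janus-bands`)
— brick `NestedDiffParAll`

**`HPar1`: the interval normal form `HDiff₁` with one bound parallel to the letter of its own
fibre.** In the binder format of the hypothesis `HDiff₁` of `rebaseSimpleZeroTwo_of_intervalGGset`
(clean nest `A(y) < tᵢ < tⱼ < B(y)` over the literal interval `{l < y < u}`, inner letter `cᵢ`
constant, outer letter `cⱼ` of slope `λ ≠ 0`, base pole outside the open interval, literal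
`GS 0 2` integrand with exponents `0, 1`), under the extra hypothesis
`A.1 (Fin.last 0) = ci.1 (Fin.last 0) ∨ B.1 (Fin.last 0) = cj.1 (Fin.last 0)`, the
representation is good for `GG 0 2 2` (`rebaseSimpleZero_nestedDiffHPar1`, registered; structured
form `RebaseE2.hparS : RebaseE1.HParS T p a i j ci cj`). Both cases are moved to the normalised
frame of `RebaseE2.good_frame` by rule (2): `B ∥ cⱼ` by the joint shear along `λ`
(`RebaseNest.nest_shear`: top and outer letter become constant, the inner letter gets the slope
`−λ`), `A` constant by the reflection `t ↦ −t` (`RebaseNest.nest_reflect`: the fibres exchange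
their roles, `−A` is the constant top, `−cᵢ` the constant outer letter, `−cⱼ` the sloped inner
letter).

References: M. Kontsevich, D. Zagier, *Periods* (2001), §1.2, rules (1a), (1b), (2).
-/

noncomputable section

open Set MeasureTheory MvPolynomial
open Literature.NumberTheory.Transcendental Literature.ModelTheory.ExponentialFields

namespace Summit.KontsevichZagierPeriods.ArrangementNormalForm.JanusBands

namespace RebaseE2

open SeparatePos RebasePos RebaseZero RebaseNest RebaseDiff RebaseE1

variable {i j : Fin 2} {s : KZ.IntegralRep (0 + 1 + 2)} {l u : ℚ} {A B : Cf} {T : BData}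
  {p : MvPolynomial (Fin 0) ℚ} {a : Fin 2 → Option Cf} {ci cj : Cf}

/-- **`HPar1`, case `B ∥ cⱼ`.** The joint shear of both fibres along the outer letter slope `λ`
(rule 2, `RebaseNest.nest_shear`) turns the datum into a datum of the normalised frame (top
`B.2` and outer letter constant, inner letter of slope `−λ ≠ 0`), which is good by
`RebaseE2.good_frame`. [Kontsevich–Zagier 2001, §1.2, rule (2)] -/
theorem good_parB (h : IsDN s l u A B T p a i j) (hL : LData T a i j ci cj)
    (hB : B.1 (Fin.last 0) = cj.1 (Fin.last 0)) : Good 2 (KZ.of s) := by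
  set lam : ℚ := cj.1 (Fin.last 0) with hlamdef
  obtain ⟨s', hbd', hdom', hint', hrel⟩ :=
    nest_shear s _ T.L T.e p T.ℓ₁ T.ℓ₂ T.n₁ T.n₂ a A B h.bdd h.dom h.int lam
  obtain ⟨hai', hci'⟩ := pullA_shear_some (lam := lam) hL.hi
  obtain ⟨haj', hcj'⟩ := pullA_shear_some (lam := lam) hL.hj
  have hB' : pullC 1 lam 0 B = mk 0 B.2 := by
    rw [pullC_mk, hB, hlamdef, sub_self, zero_div, Prod.snd_zero, sub_zero, div_one]
  rw [hB'] at hdom'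
  have hAv : ∀ y : ℝ, ev (pullC 1 lam 0 A) y = ev A y - lam * y := fun y => by
    rw [pullC_mk, ev_mk, ev, Prod.snd_zero, sub_zero, div_one, div_one, Rat.cast_sub]; ring
  have hBv : ∀ y : ℝ, ev (mk 0 B.2) y = ev B y - lam * y := fun y => by
    rw [ev_mk0, ev, hB, hlamdef]; ring
  have h' : IsDN s' l u (pullC 1 lam 0 A) (mk 0 B.2) T (MvPolynomial.C (pullQ (fun _ : Fin 2 => (1 : ℚ)) a) * p)
      (pullA (fun _ : Fin 2 => (1 : ℚ)) (fun _ => lam) (fun _ => 0) a) i j :=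
    ⟨h.ne, hdom', hint', hbd', h.lu, fun y h1 h2 => by rw [hAv, hBv]; linarith [h.AB y h1 h2], h.pole⟩
  refine RebaseZero.good_of_sub_mem hrel (good_frame h' hai' haj' ?_ ?_ hL.n1 hL.n2)
  · rw [hcj', hlamdef, sub_self]
  · rw [hci', hL.ci0, zero_sub, neg_ne_zero]; exact hL.cj0

/-- **`HPar1`, case `A` constant.** The reflection `t ↦ −t` of both fibres (rule 2,
`RebaseNest.nest_reflect`) turns the datum into a datum of the normalised frame with the roles
of the fibres exchanged (constant top `−A`, constant outer letter `−cᵢ`, inner letter `−cⱼ` of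
slope `−λ ≠ 0`), which is good by `RebaseE2.good_frame`. [Kontsevich–Zagier 2001, §1.2, rule (2)] -/
theorem good_parA (h : IsDN s l u A B T p a i j) (hL : LData T a i j ci cj) (hA : A.1 (Fin.last 0) = 0) :
    Good 2 (KZ.of s) := by
  obtain ⟨s', hbd', hdom', hint', hrel⟩ :=
    nest_reflect s _ T.L T.e p T.ℓ₁ T.ℓ₂ T.n₁ T.n₂ a h.ne A B h.bdd h.dom h.int
  have hA' : -A = mk 0 (-A.2) := by rw [← mk_eta (-A), neg_fst, hA, neg_zero, Prod.snd_neg]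
  rw [hA'] at hdom'
  have hai' : (fun l => (a l).map Neg.neg) i = some (-ci) := by simp only [hL.hi, Option.map_some]
  have haj' : (fun l => (a l).map Neg.neg) j = some (-cj) := by simp only [hL.hj, Option.map_some]
  have h' : IsDN s' l u (-B) (mk 0 (-A.2)) T (MvPolynomial.C (pullQ (fun _ : Fin 2 => (-1 : ℚ)) a) * p)
      (fun l => (a l).map Neg.neg) j i :=
    ⟨h.ne.symm, hdom', hint', hbd', h.lu, fun y h1 h2 => by
      rw [ev_neg, ev_mk0, Rat.cast_neg, ← ev_of_fst_eq_zero hA y]; linarith [h.AB y h1 h2], h.pole⟩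
  refine RebaseZero.good_of_sub_mem hrel (good_frame h' haj' hai' ?_ ?_ hL.n1 hL.n2)
  · rw [neg_fst, hL.ci0, neg_zero]
  · rw [neg_fst, neg_ne_zero]; exact hL.cj0

/-- **`HPar1` on structured data** (`RebaseE1.HParS`): every datum of `HDiff₁` one of whose bounds
is parallel to the letter of its own fibre is good for `GG 0 2 2`.
[Kontsevich–Zagier 2001, §1.2, rules (1a), (1b), (2)] -/
theorem hparS (hL : LData T a i j ci cj) : HParS T p a i j ci cj := fun _ _ _ _ _ h hpar => by
  rcases hpar with hA | hB
  · exact good_parA h hL (hA.trans hL.ci0)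
  · exact good_parB h hL hB

end RebaseE2

/-- **`HPar1` (part of `stub_rebaseSimpleZeroTwo`, line `janus-bands`): the interval normal form
`HDiff₁` of the two-fibre rebase with ONE BOUND PARALLEL TO THE LETTER OF ITS OWN FIBRE, closed.**
In the binder format of the hypothesis `HDiff₁` of `rebaseSimpleZeroTwo_of_intervalGGset` (clean
nest `A(y) < tᵢ < tⱼ < B(y)` over the literal interval `{l < y < u}`, inner letter `cᵢ` constant,
outer letter `cⱼ` of non-zero `y`-slope, base pole `ℓ₂.2` outside the open interval, literal
`GS 0 2` integrand with exponents `0, 1`), under the extra hypothesis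
`A.1 (Fin.last 0) = ci.1 (Fin.last 0) ∨ B.1 (Fin.last 0) = cj.1 (Fin.last 0)` (`A ∥ cᵢ`, i.e.
`A` constant, or `B ∥ cⱼ`), the representation is congruent modulo `KZ.relations` to the subgroup
generated by the literal rebased class `GG 0 2 2` (`RebaseE2.hparS`: shear or reflection to the
normalised frame, then the E2 case analysis `RebaseE2.good_frame` — gap, edge, corner and base
blow-up pieces after cutting the interval at the rational crossings and the nest at the wall).
[Kontsevich–Zagier 2001, §1.2, rules (1a), (1b), (2)] -/
theorem rebaseSimpleZero_nestedDiffHPar1 (m : ℕ) (s : KZ.IntegralRep (0 + 1 + 2)) (L : Fin m → (Fin 0 → ℚ) × ℚ) (e : Fin m → ℕ) (p : MvPolynomial (Fin 0) ℚ) (ℓ₁ ℓ₂ : (Fin 0 → ℚ) × ℚ) (a : Fin 2 → Option ((Fin (0 + 1) → ℚ) × ℚ)) (lo hi : Fin 2 → Fin 2 ⊕ ((Fin (0 + 1) → ℚ) × ℚ)) (i j : Fin 2) (A B ci cj : (Fin (0 + 1) → ℚ) × ℚ) (l u : ℚ) (hij : i ≠ j) (hloi : lo i = Sum.inr A) (hhii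 : hi i = Sum.inl j) (hloj : lo j = Sum.inl i) (hhij : hi j = Sum.inr B) (hai : a i = some ci) (haj : a j = some cj) (hci : ci.1 (Fin.last 0) = 0) (hcj : cj.1 (Fin.last 0) ≠ 0) (hpar : A.1 (Fin.last 0) = ci.1 (Fin.last 0) ∨ B.1 (Fin.last 0) = cj.1 (Fin.last 0)) (hlu : l < u) (hAB : ∀ y : ℝ, (l : ℝ) < y → y < (u : ℝ) → RebaseZero.ev A y < RebaseZero.ev B y) (hpole : ℓ₂.2 ≤ l ∨ u ≤ ℓ₂.2) (hbd : Bornology.IsBounded s.domain) (hdom : s.domain = SeparatePos.gDom 0 2 2 ![RebaseZero.mk 1 (-l), RebaseZero.mk (-1) u] lo hi) (hint : EqOn s.integrand (RebasePos.glit 0 2 p L e ℓ₁ ℓ₂ 0 1 a) s.domain) : ∃ c ∈ AddSubgroup.closure (SeparatePos.GGset 0 2 2), KZ.of s - c ∈ KZ.relations := by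
  obtain ⟨hlo, hhi⟩ := RebaseNest.eq_nlo_nhi hij hloi hhii hloj hhij
  subst hlo hhi
  have h : RebaseE1.IsDN s l u A B ⟨m, L, e, ℓ₁, ℓ₂, 0, 1⟩ p a i j := ⟨hij, hdom, hint, hbd, hlu, hAB, hpole⟩
  exact RebaseE2.hparS (p := p) ⟨hij, hai, haj, hci, hcj, rfl, rfl⟩ s l u A B h hpar

end Summit.KontsevichZagierPeriods.ArrangementNormalForm.JanusBands
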